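import Literature.Probability.LatticeModels.ThermodynamicLimit
import HarnessLib

/-!
# Axis-parallel runs of a finite subset of `ℤ^d`: ends, the end involution, long runs

Topic `Probability/LatticeModels` (pure combinatorics of `ℤ^d = Site d`). The bookkeeping device of
the contour-energy estimate of van Enter–Fernández–Sokal 1993, App. B.5.3 ("we choose one
coordinate axis … and perform the cancellations by sweeping in order along it"): for a finite
`T ⊆ ℤ^d`, the maximal axis-parallel segments ("runs") of `T`, their ends, and the involution
exchanging the two ends of a run. Everything is proved; there are no named facts.

* `axisShift t i k = t + k eᵢ`.
* `ends T` — the finite set of ENDS `(t, i, s)` (`t ∈ T`, `s = ±1`, `t + s eᵢ ∉ T`); the site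
  `t + s eᵢ` is the END SITE (`endSite`).
* `runLen T t i s` — the length of the run of `T` through `t` swept from `t` in the direction
  `-s eᵢ` (the least `k ≥ 1` with `t - k s eᵢ ∉ T`); `otherEnd T t i s = t - (runLen - 1) s eᵢ`,
  `bwdRun` (the run as a finite set, of cardinality `runLen`).
* `endFlip T (t, i, s) = (otherEnd T t i s, i, -s)` — **an involution of `ends T`**
  (`endFlip_endFlip`), exchanging the two ends of each run.
* `card_filter_sub_card_filter_eq` — for any set `A` of sites ("good" end sites):
  `#{good ends} - #{bad ends} = #{ends good at both ends of their run} - #{ends bad at both ends}`.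
* `disjoint_bwdRun`, `mul_card_longEnds_le` — distinct `(i, s)`-ends have disjoint runs, so
  `D · #{ends with runLen ≥ D} ≤ 2d · #T`.

## References

* A. C. D. van Enter, R. Fernández, A. D. Sokal, J. Stat. Phys. 72 (1993) 879, App. B.5.3
  [VanenterFernandezSokal1993].
* S. Friedli, Y. Velenik, *Statistical Mechanics of Lattice Systems* (CUP 2017), §3.7.2
  (Peierls contours) [FriedliVelenik2017].
-/

namespace Literature.Probability.LatticeModels

open Finset

variable {d : ℕ}

/-! ### Moving along a coordinate axis -/

/-- `t + k eᵢ`: the site `t` moved by `k` along the `i`-th axis. [folklore] -/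
def axisShift (t : Site d) (i : Fin d) (k : ℤ) : Site d :=
  t + Pi.single i k

/-- The moved coordinate. [folklore] -/
@[simp] theorem axisShift_apply_same (t : Site d) (i : Fin d) (k : ℤ) :
    axisShift t i k i = t i + k := by
  simp [axisShift]

/-- The other coordinates are unchanged. [folklore] -/
@[simp] theorem axisShift_apply_ne (t : Site d) {i j : Fin d} (h : j ≠ i) (k : ℤ) :
    axisShift t i k j = t j := by
  simp [axisShift, h]

/-- Moving by `0`. [folklore] -/
@[simp] theorem axisShift_zero (t : Site d) (i : Fin d) : axisShift t i 0 = t := by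
  simp [axisShift]

/-- Moving twice along the same axis. [folklore] -/
theorem axisShift_axisShift (t : Site d) (i : Fin d) (k k' : ℤ) :
    axisShift (axisShift t i k) i k' = axisShift t i (k + k') := by
  simp [axisShift, add_assoc, ← Pi.single_add]

/-- Moving along an axis is injective in the displacement. [folklore] -/
theorem axisShift_injective (t : Site d) (i : Fin d) : Function.Injective (axisShift t i) := by
  intro k k' h
  have := congrFun h i
  simpa using this

/-- `axisShift t i k = axisShift t i k' ↔ k = k'`. [folklore] -/
theorem axisShift_eq_iff (t : Site d) (i : Fin d) {k k' : ℤ} :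
    axisShift t i k = axisShift t i k' ↔ k = k' :=
  (axisShift_injective t i).eq_iff

/-- Recovering `t` from a moved site. [folklore] -/
theorem eq_axisShift_of_axisShift_eq {t t' : Site d} {i : Fin d} {k k' : ℤ}
    (h : axisShift t i k = axisShift t' i k') : t' = axisShift t i (k - k') := by
  have := congrArg (fun z => axisShift z i (-k')) h
  rw [axisShift_axisShift, axisShift_axisShift, add_neg_cancel, axisShift_zero] at this
  rw [← this, sub_eq_add_neg]

/-! ### Ends of runs -/

/-- `(t, i, s)` is an END of `T`: `t ∈ T` and `t + s eᵢ ∉ T` (`s = ±1`).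
[cite: VanenterFernandezSokal1993, App. B.5.3] -/
def IsEnd (T : Finset (Site d)) (t : Site d) (i : Fin d) (s : ℤˣ) : Prop :=
  t ∈ T ∧ axisShift t i (s : ℤ) ∉ T

/-- The END SITE of `p = (t, i, s)`: the site `t + s eᵢ` just beyond the end.
[cite: VanenterFernandezSokal1993, App. B.5.3] -/
def endSite (p : Site d × Fin d × ℤˣ) : Site d :=
  axisShift p.1 p.2.1 (p.2.2 : ℤ)

/-- The finite set of ends of `T`. [cite: VanenterFernandezSokal1993, App. B.5.3] -/
def ends (T : Finset (Site d)) : Finset (Site d × Fin d × ℤˣ) :=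
  (T ×ˢ ((Finset.univ : Finset (Fin d)) ×ˢ (Finset.univ : Finset ℤˣ))).filter
    fun p => endSite p ∉ T

/-- Membership in `ends`. [folklore] -/
theorem mem_ends {T : Finset (Site d)} {p : Site d × Fin d × ℤˣ} :
    p ∈ ends T ↔ IsEnd T p.1 p.2.1 p.2.2 := by
  simp only [ends, mem_filter, mem_product, mem_univ, and_true, IsEnd, endSite]

/-! ### The run through an end, swept backwards -/

/-- Sweeping from `t` in the direction `-s eᵢ` one eventually leaves the finite set `T`.
[folklore] -/
theorem exists_axisShift_notMem (T : Finset (Site d)) (t : Site d) (i : Fin d) (s : ℤˣ) :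
    ∃ k : ℕ, 1 ≤ k ∧ axisShift t i (-(s : ℤ) * k) ∉ T := by
  by_contra hall
  push Not at hall
  -- the `#T + 1` sites `t - s eᵢ, …, t - (#T + 1) s eᵢ` would be distinct points of `T`
  set f : ℕ → Site d := fun j => axisShift t i (-(s : ℤ) * ((j + 1 : ℕ) : ℤ)) with hf
  have hinj : Function.Injective f := by
    intro j j' h
    have h1 := (axisShift_injective t i) h
    have hs : (s : ℤ) ≠ 0 := Units.ne_zero s
    have h2 : ((j + 1 : ℕ) : ℤ) = ((j' + 1 : ℕ) : ℤ) := by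
      have := mul_left_cancel₀ (neg_ne_zero.2 hs) h1
      exact_mod_cast this
    omega
  have hsub : (Finset.range (T.card + 1)).image f ⊆ T := by
    intro z hz
    obtain ⟨j, -, rfl⟩ := mem_image.1 hz
    exact hall (j + 1) (by omega)
  have hcard : ((Finset.range (T.card + 1)).image f).card = T.card + 1 := by
    rw [card_image_of_injective _ hinj, card_range]
  have := card_le_card hsub
  omega

/-- **The length of the run** of `T` through `t` swept in the direction `-s eᵢ`: the least
`k ≥ 1` with `t - k s eᵢ ∉ T` (for `t ∈ T`, the sites `t, t - s eᵢ, …, t - (k-1) s eᵢ` all lie in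
`T`). [cite: VanenterFernandezSokal1993, App. B.5.3] -/
noncomputable def runLen (T : Finset (Site d)) (t : Site d) (i : Fin d) (s : ℤˣ) : ℕ :=
  Nat.find (exists_axisShift_notMem T t i s)

/-- `runLen ≥ 1`. [folklore] -/
theorem one_le_runLen (T : Finset (Site d)) (t : Site d) (i : Fin d) (s : ℤˣ) :
    1 ≤ runLen T t i s :=
  (Nat.find_spec (exists_axisShift_notMem T t i s)).1

/-- The site just beyond the backward end is not in `T`. [folklore] -/
theorem axisShift_runLen_notMem (T : Finset (Site d)) (t : Site d) (i : Fin d) (s : ℤˣ) :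
    axisShift t i (-(s : ℤ) * runLen T t i s) ∉ T :=
  (Nat.find_spec (exists_axisShift_notMem T t i s)).2

/-- Minimality of `runLen`. [folklore] -/
theorem runLen_le_of_notMem {T : Finset (Site d)} {t : Site d} {i : Fin d} {s : ℤˣ} {k : ℕ}
    (hk1 : 1 ≤ k) (hk : axisShift t i (-(s : ℤ) * k) ∉ T) : runLen T t i s ≤ k :=
  Nat.find_min' _ ⟨hk1, hk⟩

/-- The points of the run lie in `T`: `t - k s eᵢ ∈ T` for `k < runLen` (`t ∈ T`). [folklore] -/
theorem axisShift_mem_of_lt_runLen {T : Finset (Site d)} {t : Site d} {i : Fin d} {s : ℤˣ}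
    (ht : t ∈ T) {k : ℕ} (hk : k < runLen T t i s) : axisShift t i (-(s : ℤ) * k) ∈ T := by
  rcases Nat.eq_zero_or_pos k with rfl | hk0
  · simpa using ht
  · by_contra h
    exact Nat.find_min (exists_axisShift_notMem T t i s) hk ⟨hk0, h⟩

/-- **The other end of the run**: `t - (runLen - 1) s eᵢ`, the last point of `T` met when sweeping
from `t` in the direction `-s eᵢ`. [cite: VanenterFernandezSokal1993, App. B.5.3] -/
noncomputable def otherEnd (T : Finset (Site d)) (t : Site d) (i : Fin d) (s : ℤˣ) : Site d :=
  axisShift t i (-(s : ℤ) * ((runLen T t i s - 1 : ℕ) : ℤ))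

/-- The other end lies in `T` (for `t ∈ T`). [folklore] -/
theorem otherEnd_mem {T : Finset (Site d)} {t : Site d} (ht : t ∈ T) (i : Fin d) (s : ℤˣ) :
    otherEnd T t i s ∈ T :=
  axisShift_mem_of_lt_runLen ht (Nat.sub_lt (one_le_runLen T t i s) Nat.one_pos)

/-- One more step beyond the other end leaves `T`. [folklore] -/
theorem axisShift_otherEnd (T : Finset (Site d)) (t : Site d) (i : Fin d) (s : ℤˣ) :
    axisShift (otherEnd T t i s) i (-(s : ℤ)) = axisShift t i (-(s : ℤ) * runLen T t i s) := by
  rw [otherEnd, axisShift_axisShift]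
  congr 1
  have h1 := one_le_runLen T t i s
  push_cast [Nat.cast_sub h1]
  ring

/-- The other end is an end, of the opposite orientation. [folklore] -/
theorem isEnd_otherEnd {T : Finset (Site d)} {t : Site d} (ht : t ∈ T) (i : Fin d) (s : ℤˣ) :
    IsEnd T (otherEnd T t i s) i (-s) := by
  refine ⟨otherEnd_mem ht i s, ?_⟩
  rw [Units.val_neg, axisShift_otherEnd]
  exact axisShift_runLen_notMem T t i s

/-- Sweeping forward from the other end retraces the run: the run of `otherEnd T t i s` in the
direction `+s eᵢ` has the same length (for an end `(t, i, s)`). [folklore] -/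
theorem runLen_otherEnd {T : Finset (Site d)} {t : Site d} {i : Fin d} {s : ℤˣ}
    (h : IsEnd T t i s) : runLen T (otherEnd T t i s) i (-s) = runLen T t i s := by
  set ℓ := runLen T t i s with hℓ
  have h1 : 1 ≤ ℓ := one_le_runLen T t i s
  -- the sites swept from the other end
  have hpt : ∀ k : ℕ, axisShift (otherEnd T t i s) i (-((-s : ℤˣ) : ℤ) * k) =
      axisShift t i ((s : ℤ) * ((k : ℤ) - ((ℓ - 1 : ℕ) : ℤ))) := by
    intro k
    rw [otherEnd, axisShift_axisShift, Units.val_neg]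
    congr 1; ring
  apply le_antisymm
  · -- at `k = ℓ` we reach `t + s eᵢ ∉ T`
    refine runLen_le_of_notMem h1 ?_
    rw [hpt ℓ]
    have : (s : ℤ) * ((ℓ : ℤ) - ((ℓ - 1 : ℕ) : ℤ)) = (s : ℤ) := by
      push_cast [Nat.cast_sub h1]; ring
    rw [this]
    exact h.2
  · -- for `1 ≤ k < ℓ` the swept site is a point of the original run
    by_contra hlt
    push Not at hlt
    set k := runLen T (otherEnd T t i s) i (-s) with hk
    have hk1 : 1 ≤ k := one_le_runLen _ _ _ _
    have hnot := axisShift_runLen_notMem T (otherEnd T t i s) i (-s)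
    rw [← hk, hpt k] at hnot
    have hmem : axisShift t i (-(s : ℤ) * ((ℓ - 1 - k : ℕ) : ℤ)) ∈ T :=
      axisShift_mem_of_lt_runLen h.1 (by omega)
    have heq : (s : ℤ) * ((k : ℤ) - ((ℓ - 1 : ℕ) : ℤ)) = -(s : ℤ) * ((ℓ - 1 - k : ℕ) : ℤ) := by
      push_cast [Nat.cast_sub h1, Nat.cast_sub (show k ≤ ℓ - 1 by omega)]; ring
    rw [heq] at hnot
    exact hnot hmem

/-- **The other end of the other end is the original end.** [folklore] -/
theorem otherEnd_otherEnd {T : Finset (Site d)} {t : Site d} {i : Fin d} {s : ℤˣ}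
    (h : IsEnd T t i s) : otherEnd T (otherEnd T t i s) i (-s) = t := by
  rw [otherEnd, runLen_otherEnd h, otherEnd, axisShift_axisShift, Units.val_neg]
  have : -(s : ℤ) * ((runLen T t i s - 1 : ℕ) : ℤ) + -(-(s : ℤ)) * ((runLen T t i s - 1 : ℕ) : ℤ)
      = 0 := by ring
  rw [this, axisShift_zero]

/-! ### The end involution -/

/-- **The end involution**: `(t, i, s) ↦ (otherEnd, i, -s)`, exchanging the two ends of a run.
[cite: VanenterFernandezSokal1993, App. B.5.3] -/
noncomputable def endFlip (T : Finset (Site d)) (p : Site d × Fin d × ℤˣ) : Site d × Fin d × ℤˣ :=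
  (otherEnd T p.1 p.2.1 p.2.2, p.2.1, -p.2.2)

/-- `endFlip` maps ends to ends. [folklore] -/
theorem endFlip_mem_ends {T : Finset (Site d)} {p : Site d × Fin d × ℤˣ} (hp : p ∈ ends T) :
    endFlip T p ∈ ends T :=
  mem_ends.2 (isEnd_otherEnd (mem_ends.1 hp).1 _ _)

/-- `endFlip` is an involution on ends. [folklore] -/
theorem endFlip_endFlip {T : Finset (Site d)} {p : Site d × Fin d × ℤˣ} (hp : p ∈ ends T) :
    endFlip T (endFlip T p) = p := by
  obtain ⟨t, i, s⟩ := p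
  simp only [endFlip, neg_neg, Prod.mk.injEq, and_true]
  exact otherEnd_otherEnd (mem_ends.1 hp)

/-- The end site of the flipped end is the site just beyond the backward end of the run:
`t - runLen · s eᵢ`. [folklore] -/
theorem endSite_endFlip (T : Finset (Site d)) (p : Site d × Fin d × ℤˣ) :
    endSite (endFlip T p) = axisShift p.1 p.2.1 (-(p.2.2 : ℤ) * runLen T p.1 p.2.1 p.2.2) := by
  simp only [endSite, endFlip, Units.val_neg]
  exact axisShift_otherEnd T p.1 p.2.1 p.2.2

/-- **Good minus bad ends = doubly good minus doubly bad.** For any set `A` of sites, classify an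
end as good if its end site lies in `A`. Ends that are good but whose run is bad at the other end
are exchanged by `endFlip` with ends that are bad but good at the other end, so they cancel:
`#{good} - #{bad} = #{good at both ends} - #{bad at both ends}`.
[cite: VanenterFernandezSokal1993, App. B.5.3] -/
theorem card_filter_sub_card_filter_eq (T A : Finset (Site d)) :
    (((ends T).filter fun p => endSite p ∈ A).card : ℤ) -
        ((ends T).filter fun p => endSite p ∉ A).card =
      (((ends T).filter fun p => endSite p ∈ A ∧ endSite (endFlip T p) ∈ A).card : ℤ) -
        ((ends T).filter fun p => endSite p ∉ A ∧ endSite (endFlip T p) ∉ A).card := by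
  classical
  -- split each side according to the other end
  have hg : ((ends T).filter fun p => endSite p ∈ A).card =
      ((ends T).filter fun p => endSite p ∈ A ∧ endSite (endFlip T p) ∈ A).card +
        ((ends T).filter fun p => endSite p ∈ A ∧ endSite (endFlip T p) ∉ A).card := by
    rw [← card_union_of_disjoint]
    · congr 1; ext p; simp only [mem_filter, mem_union]; tauto
    · exact disjoint_filter.2 fun p _ h1 h2 => h2.2 h1.2
  have hb : ((ends T).filter fun p => endSite p ∉ A).card =
      ((ends T).filter fun p => endSite p ∉ A ∧ endSite (endFlip T p) ∈ A).card +
        ((ends T).filter fun p => endSite p ∉ A ∧ endSite (endFlip T p) ∉ A).card := by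
    rw [← card_union_of_disjoint]
    · congr 1; ext p; simp only [mem_filter, mem_union]; tauto
    · exact disjoint_filter.2 fun p _ h1 h2 => h2.2 h1.2
  -- the mixed classes are in bijection under `endFlip`
  have hmix : ((ends T).filter fun p => endSite p ∈ A ∧ endSite (endFlip T p) ∉ A).card =
      ((ends T).filter fun p => endSite p ∉ A ∧ endSite (endFlip T p) ∈ A).card := by
    refine card_nbij' (endFlip T) (endFlip T) ?_ ?_ ?_ ?_
    · intro p hp
      rw [mem_coe, mem_filter] at hp ⊢
      refine ⟨endFlip_mem_ends hp.1, hp.2.2, ?_⟩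
      rw [endFlip_endFlip hp.1]; exact hp.2.1
    · intro p hp
      rw [mem_coe, mem_filter] at hp ⊢
      refine ⟨endFlip_mem_ends hp.1, hp.2.2, ?_⟩
      rw [endFlip_endFlip hp.1]; exact hp.2.1
    · intro p hp
      rw [mem_coe, mem_filter] at hp
      exact endFlip_endFlip hp.1
    · intro p hp
      rw [mem_coe, mem_filter] at hp
      exact endFlip_endFlip hp.1
  rw [hg, hb, hmix]
  push_cast
  ring

/-! ### Runs as finite sets; distinct ends have disjoint runs -/

/-- The run through the end `(t, i, s)` as a finite set: `{t - k s eᵢ : k < runLen}`.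
[cite: VanenterFernandezSokal1993, App. B.5.3] -/
noncomputable def bwdRun (T : Finset (Site d)) (t : Site d) (i : Fin d) (s : ℤˣ) : Finset (Site d) :=
  (Finset.range (runLen T t i s)).image fun k : ℕ => axisShift t i (-(s : ℤ) * k)

/-- Membership in `bwdRun`. [folklore] -/
theorem mem_bwdRun {T : Finset (Site d)} {t : Site d} {i : Fin d} {s : ℤˣ} {z : Site d} :
    z ∈ bwdRun T t i s ↔ ∃ k : ℕ, k < runLen T t i s ∧ axisShift t i (-(s : ℤ) * k) = z := by
  simp [bwdRun]

/-- A run has `runLen` points. [folklore] -/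
theorem card_bwdRun (T : Finset (Site d)) (t : Site d) (i : Fin d) (s : ℤˣ) :
    (bwdRun T t i s).card = runLen T t i s := by
  rw [bwdRun, card_image_of_injective, card_range]
  intro k k' h
  have h1 := (axisShift_injective t i) h
  have hs : (s : ℤ) ≠ 0 := Units.ne_zero s
  have := mul_left_cancel₀ (neg_ne_zero.2 hs) h1
  exact_mod_cast this

/-- A run lies in `T` (for `t ∈ T`). [folklore] -/
theorem bwdRun_subset {T : Finset (Site d)} {t : Site d} (ht : t ∈ T) (i : Fin d) (s : ℤˣ) :
    bwdRun T t i s ⊆ T := by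
  intro z hz
  obtain ⟨k, hk, rfl⟩ := mem_bwdRun.1 hz
  exact axisShift_mem_of_lt_runLen ht hk

/-- `t` lies on its own run. [folklore] -/
theorem self_mem_bwdRun (T : Finset (Site d)) (t : Site d) (i : Fin d) (s : ℤˣ) :
    t ∈ bwdRun T t i s :=
  mem_bwdRun.2 ⟨0, one_le_runLen T t i s, by simp⟩

/-- A point strictly behind an `(i, s)`-end `t`, inside its run, is not an `(i, s)`-end.
[folklore] -/
theorem not_isEnd_of_mem_run {T : Finset (Site d)} {t : Site d} {i : Fin d} {s : ℤˣ}
    (ht : t ∈ T) {m : ℕ} (hm1 : 1 ≤ m) (hm : m < runLen T t i s) :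
    ¬ IsEnd T (axisShift t i (-(s : ℤ) * m)) i s := by
  intro h
  apply h.2
  rw [axisShift_axisShift]
  have : -(s : ℤ) * (m : ℤ) + (s : ℤ) = -(s : ℤ) * ((m - 1 : ℕ) : ℤ) := by
    push_cast [Nat.cast_sub hm1]; ring
  rw [this]
  exact axisShift_mem_of_lt_runLen ht (by omega)

/-- **Distinct `(i, s)`-ends have disjoint runs** (two maximal segments of the same line either
coincide or are disjoint). [cite: VanenterFernandezSokal1993, App. B.5.3] -/
theorem disjoint_bwdRun {T : Finset (Site d)} {t t₂ : Site d} {i : Fin d} {s : ℤˣ}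
    (h1 : IsEnd T t i s) (h2 : IsEnd T t₂ i s) (hne : t ≠ t₂) :
    Disjoint (bwdRun T t i s) (bwdRun T t₂ i s) := by
  rw [Finset.disjoint_left]
  intro z hz hz2
  obtain ⟨k, hk, rfl⟩ := mem_bwdRun.1 hz
  obtain ⟨k₂, hk₂, heq⟩ := mem_bwdRun.1 hz2
  -- `t₂ = t - (k - k₂) s eᵢ`
  have ht₂ : t₂ = axisShift t i (-(s : ℤ) * ((k : ℤ) - (k₂ : ℤ))) := by
    have := eq_axisShift_of_axisShift_eq heq.symm
    rw [this]; congr 1; ring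
  rcases lt_trichotomy k k₂ with hlt | heq' | hgt
  · -- then `t` lies strictly inside the run of `t₂`
    have ht : t = axisShift t₂ i (-(s : ℤ) * ((k₂ - k : ℕ) : ℤ)) := by
      rw [ht₂, axisShift_axisShift, Nat.cast_sub hlt.le]
      have : -(s : ℤ) * ((k : ℤ) - (k₂ : ℤ)) + -(s : ℤ) * ((k₂ : ℤ) - (k : ℤ)) = 0 := by ring
      rw [this, axisShift_zero]
    have := not_isEnd_of_mem_run (i := i) (s := s) h2.1 (m := k₂ - k) (by omega) (by omega)
    rw [← ht] at this
    exact this h1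
  · subst heq'
    apply hne
    rw [ht₂]
    have : -(s : ℤ) * ((k : ℤ) - (k : ℤ)) = 0 := by ring
    rw [this, axisShift_zero]
  · have ht₂' : t₂ = axisShift t i (-(s : ℤ) * ((k - k₂ : ℕ) : ℤ)) := by
      rw [ht₂, Nat.cast_sub hgt.le]
    have := not_isEnd_of_mem_run (i := i) (s := s) h1.1 (m := k - k₂) (by omega) (by omega)
    rw [← ht₂'] at this
    exact this h2

/-- **Long runs are few**: for a fixed orientation `(i, s)`, the `(i, s)`-ends whose runs have
length `≥ D` have pairwise disjoint runs inside `T`, so `D` times their number is at most `#T`.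
[cite: VanenterFernandezSokal1993, App. B.5.3] -/
theorem mul_card_longEnds_slice_le (T : Finset (Site d)) (i : Fin d) (s : ℤˣ) (D : ℕ) :
    D * ((ends T).filter fun p => p.2.1 = i ∧ p.2.2 = s ∧ D ≤ runLen T p.1 i s).card ≤ T.card := by
  classical
  set F := (ends T).filter fun p => p.2.1 = i ∧ p.2.2 = s ∧ D ≤ runLen T p.1 i s with hF
  have hdisj : ∀ p ∈ F, ∀ q ∈ F, p ≠ q → Disjoint (bwdRun T p.1 i s) (bwdRun T q.1 i s) := by
    intro p hp q hq hpq
    rw [hF, mem_filter] at hp hq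
    obtain ⟨hpE, hpi, hps, -⟩ := hp
    obtain ⟨hqE, hqi, hqs, -⟩ := hq
    have hp1 : IsEnd T p.1 i s := by
      have := mem_ends.1 hpE; rwa [hpi, hps] at this
    have hq1 : IsEnd T q.1 i s := by
      have := mem_ends.1 hqE; rwa [hqi, hqs] at this
    have hne : p.1 ≠ q.1 := by
      intro h
      apply hpq
      obtain ⟨p1, p2, p3⟩ := p
      obtain ⟨q1, q2, q3⟩ := q
      simp only [Prod.mk.injEq] at h hpi hps hqi hqs ⊢
      exact ⟨h, hpi.trans hqi.symm, hps.trans hqs.symm⟩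
    exact disjoint_bwdRun hp1 hq1 hne
  calc D * F.card = ∑ _p ∈ F, D := by rw [sum_const, smul_eq_mul, mul_comm]
    _ ≤ ∑ p ∈ F, (bwdRun T p.1 i s).card := sum_le_sum fun p hp => by
        rw [card_bwdRun]; exact ((mem_filter.1 hp).2).2.2
    _ = (F.biUnion fun p => bwdRun T p.1 i s).card := (card_biUnion hdisj).symm
    _ ≤ T.card := card_le_card (biUnion_subset.2 fun p hp =>
        bwdRun_subset (mem_ends.1 (mem_filter.1 hp).1).1 i s)

/-- **Long runs are few, all orientations**: `D · #{ends with runLen ≥ D} ≤ 2d · #T`.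
[cite: VanenterFernandezSokal1993, App. B.5.3] -/
theorem mul_card_longEnds_le (T : Finset (Site d)) (D : ℕ) :
    D * ((ends T).filter fun p => D ≤ runLen T p.1 p.2.1 p.2.2).card ≤ 2 * d * T.card := by
  classical
  set slice : Fin d × ℤˣ → Finset (Site d × Fin d × ℤˣ) := fun o =>
    (ends T).filter fun p => p.2.1 = o.1 ∧ p.2.2 = o.2 ∧ D ≤ runLen T p.1 o.1 o.2 with hslice
  have hcover : ((ends T).filter fun p => D ≤ runLen T p.1 p.2.1 p.2.2) ⊆
      (Finset.univ : Finset (Fin d × ℤˣ)).biUnion slice := by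
    intro p hp
    rw [mem_filter] at hp
    rw [mem_biUnion]
    refine ⟨(p.2.1, p.2.2), mem_univ _, ?_⟩
    rw [hslice, mem_filter]
    exact ⟨hp.1, rfl, rfl, hp.2⟩
  have hbound : ∀ o : Fin d × ℤˣ, D * (slice o).card ≤ T.card := fun o =>
    mul_card_longEnds_slice_le T o.1 o.2 D
  calc D * ((ends T).filter fun p => D ≤ runLen T p.1 p.2.1 p.2.2).card
      ≤ D * ((Finset.univ : Finset (Fin d × ℤˣ)).biUnion slice).card :=
        Nat.mul_le_mul_left _ (card_le_card hcover)
    _ ≤ D * ∑ o ∈ (Finset.univ : Finset (Fin d × ℤˣ)), (slice o).card :=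
        Nat.mul_le_mul_left _ card_biUnion_le
    _ = ∑ o ∈ (Finset.univ : Finset (Fin d × ℤˣ)), D * (slice o).card := by rw [mul_sum]
    _ ≤ ∑ _o ∈ (Finset.univ : Finset (Fin d × ℤˣ)), T.card := sum_le_sum fun o _ => hbound o
    _ = 2 * d * T.card := by
        rw [sum_const, smul_eq_mul, card_univ, Fintype.card_prod, Fintype.card_fin,
          Fintype.card_units_int]
        ring

end Literature.Probability.LatticeModels
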